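import Literature.Geometry.Lorentzian.KerrHawkingField

/-!
# `HawkingExtensionIsKerr` (crux `stmt-FinalStateConjecture-17840`): the Killing–timelike collar
# is what excludes extremal Kerr — at `a = M` the Hawking field has NO timelike collar

Negative-lane TIGHTNESS lemma for the crux `HawkingExtensionIsKerr` (the dock of route
`ZeroEnergyKerrOrBomb`; cdisprove seat, cycle 1).  The crux concludes that the d.o.c. is a
SUB-EXTREMAL Kerr exterior (`Kerr.IsSubextremal M a`, `|a| < M`); its only hypothesis separating a
degenerate (extremal) hole from a non-degenerate one is the collar clause
`∀ x ∈ U ∩ 𝓑.doc, 𝓑.metric.val x (K x) (K x) < 0` for an open `U ⊇ 𝓔⁺` and a Killing field `K`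
tangent and non-vanishing on `𝓔⁺` (for such `K` on a Kerr exterior, tangency + timelikeness just
outside force `K ∝ T + ω₊ Φ`, the Hawking field, since `g(αT + βΦ, αT + βΦ) = β'² g(Φ, Φ) ≥ 0` on
`𝓔⁺` for the transverse part `β' = β − α ω₊`).

For SUB-extremal parameters the tree PROVES the collar (DRSR Lemma 4.7.2,
`Kerr.exists_bilin_hawkingVector_neg`: `∃ ε₀ > 0`, `g(K, K) < 0` on `r₊ < r < r₊ + ε₀`).  Here we
prove that **at `a = M` the same statement is FALSE** (`not_exists_collar_hawkingVector_extremal`):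
on the equatorial plane `{x₃ = 0}` of the extremal Kerr–Schild chart the Hawking field
`K = T + (1/2M) Φ` has the closed form

  `g(K, K) = (r − M)² (r + 2M) / (4 M² r)`            (`bilin_hawkingVector_extremal_equatorial`),

which is POSITIVE at every equatorial point off the horizon `{r = M}`
(`bilin_hawkingVector_extremal_equatorial_pos`): the null generator of the extremal horizon turns
SPACELIKE immediately outside it along the equator (the near-horizon form is
`r² Γ(θ)(Λ(θ)² − 1)`, `Λ = 2 sin θ/(1 + cos²θ) > 1` iff `sin θ > √3 − 1`, the band `47.1°–132.9°`;
the equator is its centre).  Consequently NO open set `U ⊇ {r = M}` of the chart carries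
`g(K, K) < 0` on `U ∩ {r > M}` (`exists_spacelike_near_horizon_extremal`: every open `U`
containing the equatorial horizon point `(0, √2 M, 0, 0)` contains exterior equatorial points where
`g(K, K) > 0`).

Reading for the crux: the collar clause is LOAD-BEARING for the word "sub-extremal" in the
conclusion — extremal Kerr (vacuum, `I⁺`-regular, future-presented in ingoing coordinates, simply
connected d.o.c., connected horizon, with the global Killing extension `K' = T + (1/2M) Φ` of its
horizon generator) passes every OTHER hypothesis of the crux on paper, and its d.o.c. is not a
sub-extremal Kerr exterior; any restate weakening the collar to "`K` causal near `𝓔⁺`" or "`K` null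
and non-vanishing on `𝓔⁺`" re-admits it.  (Packaging extremal Kerr as a `StationaryAFBlackHole`
is not attempted here; this file records the chart-level certificate.)

References: M. Dafermos, I. Rodnianski, Y. Shlapentokh-Rothman, Ann. of Math. 183 (2016),
arXiv:1402.7034, §2.2.2 and Lemma 4.7.2 (sub-extremal collar); J. Bardeen, G. Horowitz,
Phys. Rev. D 60 (1999) 104030, arXiv:hep-th/9905099, §2 (NHEK, `Λ(θ) = 2 sin θ/(1 + cos²θ)`);
P. T. Chruściel, J. L. Costa, M. Heusler, Living Rev. Relativity 15 (2012) 7, §3 (degenerate case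
of the uniqueness theorem).
-/

noncomputable section

namespace Summit.FinalStateConjecture.FinalStateConjecture.Theorems.HawkingExtensionIsKerr.Negative

open Literature.Geometry.Lorentzian Literature.Geometry.Lorentzian.Kerr

/-! ## Extremal parameters `a = M` -/

/-- `r₊(M, M) = M`: the extremal horizon radius (also `Kerr.TeukolskyPress.rPlus_extremal`, kept
private here to spare the Teukolsky import). [folklore] -/
private theorem rPlus_self (M : ℝ) : rPlus M M = M := by
  unfold rPlus
  simp

/-- `ω₊(M, M) = 1/(2M)`: the angular velocity of the extremal horizon (`M ≠ 0`).
[cite: DafermosRodnianskiShlapentokhrothman2014, §2.2.2] -/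
private theorem horizonAngularVelocity_self {M : ℝ} (hM : M ≠ 0) :
    horizonAngularVelocity M M = 1 / (2 * M) := by
  unfold horizonAngularVelocity
  rw [rPlus_self]
  field_simp

/-- **Closed form on the equatorial plane of extremal Kerr**: for `a = M > 0`, at a point of the
Kerr–Schild chart with `x₃ = 0` and `r > 0`, the Hawking field `K = T + (1/2M) Φ` has
`g(K, K) = (r − M)² (r + 2M) / (4 M² r)`.  (From the tree's `(r, σ)`-form of `g(T + cΦ, T + cΦ)`
at `σ = 1`, `c = 1/(2M)`: `−1 + (r² + M²)/(4M²) + M/(2r)`.) [folklore] -/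
theorem bilin_hawkingVector_extremal_equatorial {M : ℝ} (hM : 0 < M) {x : E4} (hx3 : x 3 = 0)
    (hr : 0 < radius M x) :
    bilin M M x (hawkingVector M M x) (hawkingVector M M x) =
      (radius M x - M) ^ 2 * (radius M x + 2 * M) / (4 * M ^ 2 * radius M x) := by
  rw [hawkingVector, bilin_basisVector_add_smul_axialVector M M _ hr,
    horizonAngularVelocity_self hM.ne', hx3]
  have hr0 : radius M x ≠ 0 := hr.ne'
  have hM0 : M ≠ 0 := hM.ne'
  field_simp
  ring

/-- **The extremal horizon generator is spacelike along the whole exterior equator**: for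
`a = M > 0`, `x₃ = 0`, `r > 0`, `r ≠ M`: `g(K, K) > 0`. [folklore] -/
theorem bilin_hawkingVector_extremal_equatorial_pos {M : ℝ} (hM : 0 < M) {x : E4} (hx3 : x 3 = 0)
    (hr : 0 < radius M x) (hne : radius M x ≠ M) :
    0 < bilin M M x (hawkingVector M M x) (hawkingVector M M x) := by
  rw [bilin_hawkingVector_extremal_equatorial hM hx3 hr]
  have h1 : 0 < (radius M x - M) ^ 2 :=
    lt_of_le_of_ne (sq_nonneg _) (Ne.symm (pow_ne_zero 2 (sub_ne_zero.2 hne)))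
  have h2 : 0 < radius M x + 2 * M := by linarith
  positivity

/-! ## Equatorial points of prescribed radius -/

/-- The third spatial coordinate of the equatorial point `(0, ρ, 0, 0)` vanishes. [folklore] -/
theorem equatorialPoint_apply_three (ρ : ℝ) :
    E4.ofTimeSpace 0 (EuclideanSpace.single 0 ρ) 3 = 0 := by
  rw [show (3 : Fin 4) = Fin.succ 2 from rfl, E4.ofTimeSpace_apply_succ]
  simp

/-- The Kerr–Schild radius of the equatorial point `(0, ρ, 0, 0)` is `√(ρ² − a²)` when
`ρ² ≥ a²` (the confocal ellipsoids degenerate to `x₁² + x₂² = r² + a²` on `{x₃ = 0}`). [folklore] -/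
theorem radius_equatorialPoint {a ρ : ℝ} (h : a ^ 2 ≤ ρ ^ 2) :
    radius a (E4.ofTimeSpace 0 (EuclideanSpace.single 0 ρ)) = √(ρ ^ 2 - a ^ 2) := by
  have h3 := equatorialPoint_apply_three ρ
  have hn : E4.spatialNorm (E4.ofTimeSpace 0 (EuclideanSpace.single 0 ρ)) = |ρ| := by
    rw [E4.spatialNorm_ofTimeSpace, EuclideanSpace.single, PiLp.norm_single, Real.norm_eq_abs]
  unfold radius
  rw [hn, sq_abs, h3]
  congr 1
  rw [show (ρ ^ 2 - a ^ 2) ^ 2 + 4 * a ^ 2 * (0 : ℝ) ^ 2 = (ρ ^ 2 - a ^ 2) ^ 2 by ring,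
    Real.sqrt_sq (by linarith)]
  ring

/-- For every `r ≥ 0` the equatorial point `(0, √(r² + a²), 0, 0)` has Kerr–Schild radius `r`. [folklore] -/
theorem radius_equatorialPoint_sqrt (a : ℝ) {r : ℝ} (hr : 0 ≤ r) :
    radius a (E4.ofTimeSpace 0 (EuclideanSpace.single 0 (√(r ^ 2 + a ^ 2)))) = r := by
  have hs : √(r ^ 2 + a ^ 2) ^ 2 = r ^ 2 + a ^ 2 := Real.sq_sqrt (by positivity)
  rw [radius_equatorialPoint (by rw [hs]; nlinarith [sq_nonneg r]), hs,
    show r ^ 2 + a ^ 2 - a ^ 2 = r ^ 2 by ring, Real.sqrt_sq hr]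

/-! ## No Killing–timelike collar at `a = M` -/

/-- **DRSR Lemma 4.7.2 is FALSE at `a = M`**: there is no `ε₀ > 0` with `g(K, K) < 0` on the
coordinate collar `r₊ < r < r₊ + ε₀` of the extremal Kerr–Schild chart (compare the tree's
`Kerr.exists_bilin_hawkingVector_neg` for `|a| < M`, whose statement at `(M, M)` this negates).
Witness: the equatorial point of radius `M + ε₀/2`. [cite: DafermosRodnianskiShlapentokhrothman2014, Lemma 4.7.2] -/
theorem not_exists_collar_hawkingVector_extremal {M : ℝ} (hM : 0 < M) :
    ¬ ∃ ε₀ : ℝ, 0 < ε₀ ∧ ∀ x : E4, rPlus M M < radius M x → radius M x < rPlus M M + ε₀ →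
        bilin M M x (hawkingVector M M x) (hawkingVector M M x) < 0 := by
  rintro ⟨ε₀, hε, h⟩
  rw [rPlus_self] at h
  have hr : 0 ≤ M + ε₀ / 2 := by linarith
  have hrad := radius_equatorialPoint_sqrt M hr
  have hlt := h (E4.ofTimeSpace 0 (EuclideanSpace.single 0 (√((M + ε₀ / 2) ^ 2 + M ^ 2))))
    (by rw [hrad]; linarith) (by rw [hrad]; linarith)
  have hpos := bilin_hawkingVector_extremal_equatorial_pos hM (equatorialPoint_apply_three _)
    (x := E4.ofTimeSpace 0 (EuclideanSpace.single 0 (√((M + ε₀ / 2) ^ 2 + M ^ 2))))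
    (by rw [hrad]; linarith) (by rw [hrad]; linarith)
  linarith

/-- **No open neighbourhood of the extremal horizon is a Killing–timelike collar**: for `a = M > 0`
every open `U ⊆ ℝ⁴` containing the equatorial horizon point `(0, √2·M, 0, 0)` (radius `M = r₊`)
contains a point of the exterior `{r > M}` at which the Hawking field is SPACELIKE.  This is the
chart-level negation of the crux's collar clause `∀ x ∈ U ∩ doc, g(K, K) < 0` for the only
candidate `K` (the horizon generator) on extremal Kerr. [folklore] -/
theorem exists_spacelike_near_horizon_extremal {M : ℝ} (hM : 0 < M) {U : Set E4} (hU : IsOpen U)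
    (hp : E4.ofTimeSpace 0 (EuclideanSpace.single 0 (√(M ^ 2 + M ^ 2))) ∈ U) :
    ∃ x ∈ U, M < radius M x ∧ 0 < bilin M M x (hawkingVector M M x) (hawkingVector M M x) := by
  -- the curve `δ ↦ (0, √((M + δ)² + M²), 0, 0)` of equatorial points of radius `M + δ`
  set c : ℝ → E4 := fun δ ↦ E4.ofTimeSpace 0 (EuclideanSpace.single 0 (√((M + δ) ^ 2 + M ^ 2)))
    with hc
  have hcont : Continuous c := by
    refine (E4.continuous_ofTimeSpace 0).comp ?_
    change Continuous fun δ : ℝ ↦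
      (WithLp.toLp 2 (Pi.single (0 : Fin 3) (√((M + δ) ^ 2 + M ^ 2))) : E3)
    exact (PiLp.continuous_toLp 2 _).comp ((continuous_single 0).comp (by fun_prop))
  have h0 : c 0 = E4.ofTimeSpace 0 (EuclideanSpace.single 0 (√(M ^ 2 + M ^ 2))) := by
    simp [hc]
  have hmem : c ⁻¹' U ∈ nhds (0 : ℝ) :=
    hcont.continuousAt.preimage_mem_nhds (by rw [h0]; exact hU.mem_nhds hp)
  obtain ⟨η, hη, hball⟩ := Metric.mem_nhds_iff.1 hmem
  have hδ : η / 2 ∈ Metric.ball (0 : ℝ) η := by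
    rw [Metric.mem_ball, dist_zero_right, Real.norm_eq_abs, abs_of_pos (by linarith)]
    linarith
  have hrad : radius M (c (η / 2)) = M + η / 2 := radius_equatorialPoint_sqrt M (by linarith)
  refine ⟨c (η / 2), hball hδ, by rw [hrad]; linarith, ?_⟩
  exact bilin_hawkingVector_extremal_equatorial_pos hM (equatorialPoint_apply_three _)
    (by rw [hrad]; linarith) (by rw [hrad]; linarith)

/-- The base point of `exists_spacelike_near_horizon_extremal` lies ON the extremal horizon:
its Kerr–Schild radius is `M = r₊(M, M)`. [folklore] -/
theorem radius_equatorialHorizonPoint {M : ℝ} (hM : 0 ≤ M) :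
    radius M (E4.ofTimeSpace 0 (EuclideanSpace.single 0 (√(M ^ 2 + M ^ 2)))) = rPlus M M := by
  rw [rPlus_self, radius_equatorialPoint_sqrt M hM]

end Summit.FinalStateConjecture.FinalStateConjecture.Theorems.HawkingExtensionIsKerr.Negative

end
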